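import Literature.RepresentationTheory.KonnoKonno2007.JunctionHyperbolicFamily
import Literature.Analysis.Distribution.SchwartzFlowSmooth
import Literature.Analysis.Distribution.SchwartzOfRealSlope
import HarnessLib

/-!
# The Schwartz-topology derivative of the hyperbolic family of a real unitary dual pair

Topic `RepresentationTheory/KonnoKonno2007`; namespace `Literature.RepresentationTheory.KonnoKonno2007.RealDualPair`.
Continuation of `JunctionHyperbolicFamily` (the hyperbolic one-parameter family
`hypOp R S p₀ q₀ t = μ₀(u)⁻¹ ∘ leviS (δ_{e^t}) ∘ μ₀(u)` of Schwartz operators on `𝓢(ℝ^{DPIdx P Q R S}, ℂ)` attached to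
an isotropic pair `e_{p₀} ± e_{q₀}` of `V = ℂ^{P ⊕ Q}`; `u = frameU R S p₀ q₀` the Siegel frame, `δ_c = 1 + (c − 1)Π` the
dilation of the `2(|R| + |S|)` plane coordinates, `Π = planeProj R S p₀ q₀`).

This file differentiates that family IN THE SCHWARTZ TOPOLOGY and makes the generator explicit:

* §1 constants of the plane dilation: `∑_k planeInd k = 2(|R| + |S|)` (`sum_planeInd`), `det δ_c = ∏_k dilWt c k`
  (`det_planeDil`), `det δ_{e^t} = e^{2(|R|+|S|)t}` and the Levi factor `|det δ_{e^t}|^{-1/2} = e^{−(|R|+|S|)t}`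
  (`leviFactor_planeDil_exp`); the operator-norm derivative `d/dt|₀ δ_{e^t}⁻¹ = −Π` (`hasDerivAt_planeDil_exp_symm`).
* §2 the generator of the Levi family `hypLevi t = leviS (δ_{e^t})`:
  `hypLeviGen f = −(|R|+|S|) f − Σ_{k ∈ plane} x_k ∂_k f` (a weighted Euler operator along the plane; the tree's
  `weightedFlowGen`), and `t⁻¹ • (hypLevi t f − f) ⟶ hypLeviGen f` in `𝓢` (`tendsto_hypLevi_sub_div`) — Folland's
  formula (4.24) differentiated; engine `Literature.Analysis.Distribution.tendsto_smul_compCLM_sub_div`.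
* §3 the generator of `hypOp`: `hypOpGen = μ₀(u)⁻¹ ∘ hypLeviGen ∘ μ₀(u)` and the slope statements
  `t⁻¹ • (hypOp t f − f) ⟶ hypOpGen f` with real and with complex (`((t:ℝ):ℂ)⁻¹`) scalars, at `0` and at every base
  point `s₀` (limit `hypOpGen (hypOp s₀ f)`), with an optional scalar cocycle `c`, `c 0 = 1`, `c'(0) = κ`
  (limit `κ • f + hypOpGen f`); the commutation `hypOpGen (hypOp s f) = hypOp s (hypOpGen f)`; and the consequences
  for scalar coefficients `s ↦ T (hypOp s f)` (`hasDerivAt_apply_hypOp`, `contDiff_apply_hypOp`).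

The complex-scalar slope at `0` is the shape in which the derivative of a one-parameter family `s ↦ ω(exp sX)` of
Schwartz operators along a hyperbolic element `X` is consumed (Folland 1989, Ch. 4: the Levi operators (4.24) and
their infinitesimal form), here for the explicit family `hypOp`.

Everything is proved from Mathlib and the imported tree files; no cited fact is used as a hypothesis; 0 records.

## References

* G. B. Folland, *Harmonic Analysis in Phase Space*, Annals of Mathematics Studies 122, Princeton UP (1989): Ch. 4,
  (4.24) (the Levi operators `f ↦ |det a|^{-1/2} f ∘ a⁻¹`), Prop. (4.39) (`μ₀(U)`). [cite: Folland1989, (4.24)]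

## Provenance

Written for the tree under the LEAN-IN-TREE rule by the pub-hodgecm formalisation cell (model-construction sub-cell,
theta-kernel lane mc-theta-1), over `JunctionHyperbolicFamily` and the tree's Schwartz flow calculus
(`SchwartzLinearFlowDeriv`, `SchwartzFlowProductRule`, `SchwartzFlowSmooth`, `SchwartzOfRealSlope`).  Nothing here is
specific to that cell.
-/

set_option autoImplicit false

noncomputable section

open Matrix Complex MeasureTheory Filter
open scoped Topology ContDiff
open Literature.Analysis.SegalBargmann Literature.Analysis.Distribution

local notation "SR" σ => SchwartzMap (σ → ℝ) ℂ

namespace Literature.RepresentationTheory.KonnoKonno2007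

namespace RealDualPair

/-! ## §1  Constants of the plane dilation -/

section PlaneConstants

variable {P Q : Type*} [Fintype P] [DecidableEq P] [Fintype Q] [DecidableEq Q]
  (R S : Type*) [Fintype R] [DecidableEq R] [Fintype S] [DecidableEq S] (p₀ : P) (q₀ : Q)

omit [DecidableEq R] [DecidableEq S] in
/-- **`∑_k planeInd k = 2(|R| + |S|)`**: the plane has `2(|R| + |S|)` real coordinates. [folklore] -/
theorem sum_planeInd : ∑ k, planeInd R S p₀ q₀ k = 2 * (Fintype.card R + Fintype.card S : ℝ) := by
  simp only [Fintype.sum_sum_type, Fintype.sum_prod_type, planeInd_ll, planeInd_lr, planeInd_rl, planeInd_rr,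
    Finset.sum_const, Finset.card_univ, smul_ite, smul_zero, Finset.sum_ite_eq', Finset.mem_univ, if_true,
    nsmul_eq_mul, mul_one]
  ring

omit [Fintype P] [Fintype Q] [Fintype R] [DecidableEq R] [Fintype S] [DecidableEq S] in
/-- the underlying linear map of `δ_c` is the diagonal map of the weights. [folklore] -/
theorem planeDil_toLinearMap (c : ℝ) (hc : c ≠ 0) :
    ((planeDil R S p₀ q₀ c hc : (DPIdx P Q R S → ℝ) ≃ₗ[ℝ] (DPIdx P Q R S → ℝ)) :
        (DPIdx P Q R S → ℝ) →ₗ[ℝ] (DPIdx P Q R S → ℝ)) = diagLin (dilWt R S p₀ q₀ c) := rfl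

/-- **`det δ_c = ∏_k dilWt c k`.** [folklore] -/
theorem det_planeDil (c : ℝ) (hc : c ≠ 0) :
    LinearMap.det ((planeDil R S p₀ q₀ c hc : (DPIdx P Q R S → ℝ) ≃ₗ[ℝ] (DPIdx P Q R S → ℝ)) :
        (DPIdx P Q R S → ℝ) →ₗ[ℝ] (DPIdx P Q R S → ℝ)) = ∏ k, dilWt R S p₀ q₀ c k := by
  rw [planeDil_toLinearMap, ← LinearMap.det_toMatrix', toMatrix'_diagLin, Matrix.det_diagonal]

omit [Fintype P] [Fintype Q] [Fintype R] [DecidableEq R] [Fintype S] [DecidableEq S] in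
/-- the dilation weight at `c = e^t` is `e^{t · planeInd k}`. [folklore] -/
theorem dilWt_exp (t : ℝ) (k : DPIdx P Q R S) :
    dilWt R S p₀ q₀ (Real.exp t) k = Real.exp (t * planeInd R S p₀ q₀ k) := by
  rcases planeInd_eq_zero_or_one R S p₀ q₀ k with h | h
  · rw [dilWt, h, mul_zero, add_zero, mul_zero, Real.exp_zero]
  · rw [dilWt, h, mul_one, mul_one, add_sub_cancel]

/-- **`det δ_{e^t} = e^{2(|R|+|S|)t}`.** [folklore] -/
theorem det_planeDil_exp (t : ℝ) :
    LinearMap.det ((planeDil R S p₀ q₀ (Real.exp t) (Real.exp_pos t).ne' :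
        (DPIdx P Q R S → ℝ) ≃ₗ[ℝ] (DPIdx P Q R S → ℝ)) : (DPIdx P Q R S → ℝ) →ₗ[ℝ] (DPIdx P Q R S → ℝ)) =
      Real.exp (2 * (Fintype.card R + Fintype.card S : ℝ) * t) := by
  rw [det_planeDil]
  simp only [dilWt_exp]
  rw [← Real.exp_sum, ← Finset.mul_sum, sum_planeInd]
  ring_nf

/-- the weight exponent `−(|R| + |S|)` of the hyperbolic Levi family. [folklore] -/
def hypWt : ℝ := -(Fintype.card R + Fintype.card S : ℝ)

/-- **The Levi factor of `δ_{e^t}`**: `|det δ_{e^t}|^{-1/2} = e^{−(|R|+|S|)t}`. [cite: Folland1989, (4.24)] -/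
theorem leviFactor_planeDil_exp (t : ℝ) :
    leviFactor (planeDil R S p₀ q₀ (Real.exp t) (Real.exp_pos t).ne') =
      ((Real.exp (hypWt R S * t) : ℝ) : ℂ) := by
  rw [leviFactor, det_planeDil_exp, abs_of_pos (Real.exp_pos _), ← Real.exp_mul, hypWt]
  congr 1
  ring_nf

/-- **`Π` as a continuous linear map.** [folklore] -/
def planeProjCLM : (DPIdx P Q R S → ℝ) →L[ℝ] (DPIdx P Q R S → ℝ) :=
  LinearMap.toContinuousLinearMap (planeProj R S p₀ q₀)

omit [DecidableEq R] [DecidableEq S] in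
/-- unfolding `planeProjCLM`. [folklore] -/
@[simp] theorem planeProjCLM_apply (x : DPIdx P Q R S → ℝ) :
    planeProjCLM R S p₀ q₀ x = planeProj R S p₀ q₀ x := rfl

omit [DecidableEq R] [DecidableEq S] in
/-- the inverse dilation family as continuous linear maps: `δ_{e^t}⁻¹ = 1 + (e^{−t} − 1) Π`. [folklore] -/
theorem planeDil_exp_symm_toCLM (t : ℝ) :
    (((planeDil R S p₀ q₀ (Real.exp t) (Real.exp_pos t).ne').symm.toContinuousLinearEquiv :
        (DPIdx P Q R S → ℝ) ≃L[ℝ] (DPIdx P Q R S → ℝ)) : (DPIdx P Q R S → ℝ) →L[ℝ] (DPIdx P Q R S → ℝ)) =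
      1 + (Real.exp (-t) - 1) • planeProjCLM R S p₀ q₀ := by
  rw [Real.exp_neg]
  exact planeDil_symm_toCLM R S p₀ q₀ _ _

omit [DecidableEq R] [DecidableEq S] in
/-- at `t = 0` the inverse dilation is the identity. [folklore] -/
theorem planeDil_exp_symm_toCLM_zero :
    (((planeDil R S p₀ q₀ (Real.exp 0) (Real.exp_pos 0).ne').symm.toContinuousLinearEquiv :
        (DPIdx P Q R S → ℝ) ≃L[ℝ] (DPIdx P Q R S → ℝ)) : (DPIdx P Q R S → ℝ) →L[ℝ] (DPIdx P Q R S → ℝ)) = 1 := by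
  rw [planeDil_exp_symm_toCLM, neg_zero, Real.exp_zero, sub_self, zero_smul, add_zero]

omit [DecidableEq R] [DecidableEq S] in
/-- **`d/dt|₀ δ_{e^t}⁻¹ = −Π`** in operator norm. [folklore] -/
theorem hasDerivAt_planeDil_exp_symm :
    HasDerivAt (fun t : ℝ =>
      (((planeDil R S p₀ q₀ (Real.exp t) (Real.exp_pos t).ne').symm.toContinuousLinearEquiv :
        (DPIdx P Q R S → ℝ) ≃L[ℝ] (DPIdx P Q R S → ℝ)) : (DPIdx P Q R S → ℝ) →L[ℝ] (DPIdx P Q R S → ℝ)))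
      (-(planeProjCLM R S p₀ q₀)) 0 := by
  simp only [planeDil_exp_symm_toCLM]
  have h1 : HasDerivAt (fun t : ℝ => Real.exp (-t)) (-1) 0 := by
    have h := ((hasDerivAt_id (0 : ℝ)).neg).exp
    simpa using h
  have h2 : HasDerivAt (fun t : ℝ => (Real.exp (-t) - 1) • planeProjCLM R S p₀ q₀)
      ((-1 : ℝ) • planeProjCLM R S p₀ q₀) 0 := (h1.sub_const 1).smul_const (planeProjCLM R S p₀ q₀)
  have h3 := h2.const_add (1 : (DPIdx P Q R S → ℝ) →L[ℝ] (DPIdx P Q R S → ℝ))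
  exact h3.congr_deriv (neg_one_smul ℝ (planeProjCLM R S p₀ q₀))

end PlaneConstants

/-! ## §2  The generator of the Levi family `hypLevi t = leviS (δ_{e^t})` -/

section LeviGen

variable {P Q : Type*} [Fintype P] [DecidableEq P] [Fintype Q] [DecidableEq Q]
  (R S : Type*) [Fintype R] [DecidableEq R] [Fintype S] [DecidableEq S] (p₀ : P) (q₀ : Q)

/-- **The generator of the hyperbolic Levi family**: `hypLeviGen f = −(|R|+|S|) f − Σ_{k ∈ plane} x_k ∂_k f`, as a real
continuous linear operator on `𝓢` (the tree's `weightedFlowGen` with weight `−(|R|+|S|)` and velocity `−Π`).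
[cite: Folland1989, (4.24)] -/
def hypLeviGen : (SR (DPIdx P Q R S)) →L[ℝ] SR (DPIdx P Q R S) :=
  weightedFlowGen ℂ ((hypWt R S : ℝ) : ℂ) (-(planeProjCLM R S p₀ q₀))

omit [DecidableEq R] [DecidableEq S] in
/-- `hypLeviGen f = hypWt • f + flowGen (−Π) f`. [folklore] -/
theorem hypLeviGen_eq (f : SR (DPIdx P Q R S)) :
    hypLeviGen R S p₀ q₀ f = ((hypWt R S : ℝ) : ℂ) • f + flowGen (-(planeProjCLM R S p₀ q₀)) f := rfl

omit [DecidableEq R] [DecidableEq S] in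
/-- **pointwise formula** `hypLeviGen f x = −(|R|+|S|) f x − Df(x)[Π x]`. [folklore] -/
theorem hypLeviGen_apply (f : SR (DPIdx P Q R S)) (x : DPIdx P Q R S → ℝ) :
    hypLeviGen R S p₀ q₀ f x = ((hypWt R S : ℝ) : ℂ) * f x - fderiv ℝ f x (planeProj R S p₀ q₀ x) := by
  rw [hypLeviGen_eq, _root_.add_apply, _root_.smul_apply, flowGen_apply, smul_eq_mul, _root_.neg_apply, map_neg,
    planeProjCLM_apply, sub_eq_add_neg]

/-- `hypLevi t f` in the weighted-composition form `e^{hypWt·t} • (f ∘ δ_{e^t}⁻¹)`. [cite: Folland1989, (4.24)] -/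
theorem hypLevi_apply_eq (t : ℝ) (f : SR (DPIdx P Q R S)) :
    hypLevi R S p₀ q₀ t f =
      ((Real.exp (hypWt R S * t) : ℝ) : ℂ) •
        SchwartzMap.compCLMOfContinuousLinearEquiv ℂ
          ((planeDil R S p₀ q₀ (Real.exp t) (Real.exp_pos t).ne').symm.toContinuousLinearEquiv) f := by
  rw [hypLevi, leviS, _root_.smul_apply, leviFactor_planeDil_exp]

/-- **The Levi family differentiated in the Schwartz topology**: `t⁻¹ • (hypLevi t f − f) ⟶ hypLeviGen f` as `t → 0`,
`t ≠ 0`. [cite: Folland1989, (4.24)] -/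
theorem tendsto_hypLevi_sub_div (f : SR (DPIdx P Q R S)) :
    Tendsto (fun t : ℝ => t⁻¹ • (hypLevi R S p₀ q₀ t f - f)) (𝓝[≠] 0) (𝓝 (hypLeviGen R S p₀ q₀ f)) := by
  have h := tendsto_smul_compCLM_sub_div ℂ (E := DPIdx P Q R S → ℝ) (F := ℂ)
    (c := fun t : ℝ => ((Real.exp (hypWt R S * t) : ℝ) : ℂ)) (κ := ((hypWt R S : ℝ) : ℂ))
    (L := fun t : ℝ => (planeDil R S p₀ q₀ (Real.exp t) (Real.exp_pos t).ne').symm.toContinuousLinearEquiv)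
    (A := -(planeProjCLM R S p₀ q₀)) (ofReal_expWeight_zero _) (hasDerivAt_ofReal_expWeight _)
    (planeDil_exp_symm_toCLM_zero R S p₀ q₀) (hasDerivAt_planeDil_exp_symm R S p₀ q₀) f
  rw [hypLeviGen_eq]
  refine h.congr fun t => ?_
  rw [hypLevi_apply_eq]

/-- the same slope with complex scalars `((t : ℝ) : ℂ)⁻¹`. [cite: Folland1989, (4.24)] -/
theorem tendsto_hypLevi_sub_div_ofReal (f : SR (DPIdx P Q R S)) :
    Tendsto (fun t : ℝ => ((t : ℝ) : ℂ)⁻¹ • (hypLevi R S p₀ q₀ t f - f)) (𝓝[≠] 0)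
      (𝓝 (hypLeviGen R S p₀ q₀ f)) :=
  tendsto_ofReal_inv_smul_iff.2 (tendsto_hypLevi_sub_div R S p₀ q₀ f)

end LeviGen

/-! ## §3  The generator of `hypOp` and the slope statements -/

section HypGen

variable {P Q : Type*} [Fintype P] [DecidableEq P] [Fintype Q] [DecidableEq Q]
  (R S : Type*) [Fintype R] [DecidableEq R] [Fintype S] [DecidableEq S] (p₀ : P) (q₀ : Q)

/-- **The generator of the hyperbolic family `hypOp`**: `hypOpGen = μ₀(u)⁻¹ ∘ hypLeviGen ∘ μ₀(u)`, `u` the Siegel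
frame, as a real continuous linear operator on `𝓢`. [cite: Folland1989, (4.24)] -/
def hypOpGen : (SR (DPIdx P Q R S)) →L[ℝ] SR (DPIdx P Q R S) :=
  ((unitaryOpPi (frameU R S p₀ q₀)⁻¹ : (SR (DPIdx P Q R S)) →L[ℂ] SR (DPIdx P Q R S)).restrictScalars ℝ).comp
    ((hypLeviGen R S p₀ q₀).comp
      ((unitaryOpPi (frameU R S p₀ q₀) : (SR (DPIdx P Q R S)) →L[ℂ] SR (DPIdx P Q R S)).restrictScalars ℝ))

/-- unfolding `hypOpGen`. [folklore] -/
@[simp] theorem hypOpGen_apply (f : SR (DPIdx P Q R S)) :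
    hypOpGen R S p₀ q₀ f =
      unitaryOpPi (frameU R S p₀ q₀)⁻¹ (hypLeviGen R S p₀ q₀ (unitaryOpPi (frameU R S p₀ q₀) f)) := rfl

/-- **`hypOp` differentiated at `0` in the Schwartz topology** (real scalars):
`t⁻¹ • (hypOp t f − f) ⟶ hypOpGen f`, `t → 0`, `t ≠ 0`. [cite: Folland1989, (4.24)] -/
theorem tendsto_hypOp_sub_div (f : SR (DPIdx P Q R S)) :
    Tendsto (fun t : ℝ => t⁻¹ • (hypOp R S p₀ q₀ t f - f)) (𝓝[≠] 0) (𝓝 (hypOpGen R S p₀ q₀ f)) := by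
  have h := ((unitaryOpPi (frameU R S p₀ q₀)⁻¹).continuous.tendsto _).comp
    (tendsto_hypLevi_sub_div R S p₀ q₀ (unitaryOpPi (frameU R S p₀ q₀) f))
  rw [hypOpGen_apply]
  refine h.congr fun t => ?_
  simp only [Function.comp_apply]
  rw [ContinuousLinearMap.map_smul_of_tower, map_sub, hypOp_apply, unitaryOpPi_inv_mul_apply]

/-- **`hypOp` differentiated at `0` in the Schwartz topology** (complex scalars):
`((t:ℝ):ℂ)⁻¹ • (hypOp t f − f) ⟶ hypOpGen f`. [cite: Folland1989, (4.24)] -/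
theorem tendsto_hypOp_sub_div_ofReal (f : SR (DPIdx P Q R S)) :
    Tendsto (fun t : ℝ => ((t : ℝ) : ℂ)⁻¹ • (hypOp R S p₀ q₀ t f - f)) (𝓝[≠] 0)
      (𝓝 (hypOpGen R S p₀ q₀ f)) :=
  tendsto_ofReal_inv_smul_iff.2 (tendsto_hypOp_sub_div R S p₀ q₀ f)

/-- **`hypOp` differentiated at every base point** (real scalars):
`t⁻¹ • (hypOp (s₀ + t) f − hypOp s₀ f) ⟶ hypOpGen (hypOp s₀ f)`. [cite: Folland1989, (4.24)] -/
theorem tendsto_hypOp_sub_div_at (f : SR (DPIdx P Q R S)) (s₀ : ℝ) :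
    Tendsto (fun t : ℝ => t⁻¹ • (hypOp R S p₀ q₀ (s₀ + t) f - hypOp R S p₀ q₀ s₀ f)) (𝓝[≠] 0)
      (𝓝 (hypOpGen R S p₀ q₀ (hypOp R S p₀ q₀ s₀ f))) := by
  refine (tendsto_hypOp_sub_div R S p₀ q₀ (hypOp R S p₀ q₀ s₀ f)).congr fun t => ?_
  rw [add_comm s₀ t, hypOp_add_apply]

/-- **`hypOp` differentiated at every base point** (complex scalars). [cite: Folland1989, (4.24)] -/
theorem tendsto_hypOp_sub_div_at_ofReal (f : SR (DPIdx P Q R S)) (s₀ : ℝ) :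
    Tendsto (fun t : ℝ => ((t : ℝ) : ℂ)⁻¹ • (hypOp R S p₀ q₀ (s₀ + t) f - hypOp R S p₀ q₀ s₀ f)) (𝓝[≠] 0)
      (𝓝 (hypOpGen R S p₀ q₀ (hypOp R S p₀ q₀ s₀ f))) :=
  tendsto_ofReal_inv_smul_iff.2 (tendsto_hypOp_sub_div_at R S p₀ q₀ f s₀)

/-- the other form of the slope at a base point: `t⁻¹ • (hypOp (s₀ + t) f − hypOp s₀ f) ⟶ hypOp s₀ (hypOpGen f)`.
[folklore] -/
theorem tendsto_hypOp_sub_div_at' (f : SR (DPIdx P Q R S)) (s₀ : ℝ) :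
    Tendsto (fun t : ℝ => t⁻¹ • (hypOp R S p₀ q₀ (s₀ + t) f - hypOp R S p₀ q₀ s₀ f)) (𝓝[≠] 0)
      (𝓝 (hypOp R S p₀ q₀ s₀ (hypOpGen R S p₀ q₀ f))) := by
  have h := ((hypOp R S p₀ q₀ s₀).continuous.tendsto _).comp (tendsto_hypOp_sub_div R S p₀ q₀ f)
  refine h.congr fun t => ?_
  simp only [Function.comp_apply]
  rw [ContinuousLinearMap.map_smul_of_tower, map_sub, hypOp_add_apply]

/-- **`hypOpGen` commutes with the family**: `hypOpGen (hypOp s f) = hypOp s (hypOpGen f)` (both are the derivative of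
the orbit at `s`; limits in the Hausdorff space `𝓢` are unique). [folklore] -/
theorem hypOpGen_hypOp_comm (s : ℝ) (f : SR (DPIdx P Q R S)) :
    hypOpGen R S p₀ q₀ (hypOp R S p₀ q₀ s f) = hypOp R S p₀ q₀ s (hypOpGen R S p₀ q₀ f) :=
  tendsto_nhds_unique (tendsto_hypOp_sub_div_at R S p₀ q₀ f s) (tendsto_hypOp_sub_div_at' R S p₀ q₀ f s)

/-- **with a scalar cocycle** `c` (`c 0 = 1`, `c'(0) = κ`; e.g. the character of a central extension or a modulus twist):
`t⁻¹ • (c t • hypOp t f − f) ⟶ κ • f + hypOpGen f` (real scalars). [folklore] -/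
theorem tendsto_smul_hypOp_sub_div {c : ℝ → ℂ} {κ : ℂ} (hc0 : c 0 = 1) (hc : HasDerivAt c κ 0)
    (f : SR (DPIdx P Q R S)) :
    Tendsto (fun t : ℝ => t⁻¹ • (c t • hypOp R S p₀ q₀ t f - f)) (𝓝[≠] 0)
      (𝓝 (κ • f + hypOpGen R S p₀ q₀ f)) :=
  tendsto_smul_sub_div hc0 hc (tendsto_hypOp_sub_div R S p₀ q₀ f)

/-- **with a scalar cocycle**, complex scalars: `((t:ℝ):ℂ)⁻¹ • (c t • hypOp t f − f) ⟶ κ • f + hypOpGen f`; with the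
trivial cocycle `c = 1`, `κ = 0` this is `tendsto_hypOp_sub_div_ofReal`. [folklore] -/
theorem tendsto_smul_hypOp_sub_div_ofReal {c : ℝ → ℂ} {κ : ℂ} (hc0 : c 0 = 1) (hc : HasDerivAt c κ 0)
    (f : SR (DPIdx P Q R S)) :
    Tendsto (fun t : ℝ => ((t : ℝ) : ℂ)⁻¹ • (c t • hypOp R S p₀ q₀ t f - f)) (𝓝[≠] 0)
      (𝓝 (κ • f + hypOpGen R S p₀ q₀ f)) :=
  tendsto_ofReal_inv_smul_iff.2 (tendsto_smul_hypOp_sub_div R S p₀ q₀ hc0 hc f)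

/-- **Scalar coefficients**: for every real continuous linear `T : 𝓢 → G`, `s ↦ T (hypOp s f)` has derivative
`T (hypOpGen (hypOp s₀ f))` at `s₀`. [folklore] -/
theorem hasDerivAt_apply_hypOp {G : Type*} [NormedAddCommGroup G] [NormedSpace ℝ G]
    (T : (SR (DPIdx P Q R S)) →L[ℝ] G) (f : SR (DPIdx P Q R S)) (s₀ : ℝ) :
    HasDerivAt (fun s : ℝ => T (hypOp R S p₀ q₀ s f)) (T (hypOpGen R S p₀ q₀ (hypOp R S p₀ q₀ s₀ f))) s₀ := by
  rw [hasDerivAt_iff_tendsto_slope_zero]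
  have h := (T.continuous.tendsto _).comp (tendsto_hypOp_sub_div_at R S p₀ q₀ f s₀)
  refine h.congr fun t => ?_
  simp only [Function.comp_apply]
  rw [map_smul, map_sub]

/-- **Scalar coefficients are smooth**: `s ↦ T (hypOp s f)` is `C^∞` for every real continuous linear `T : 𝓢 → G`.
[folklore] -/
theorem contDiff_apply_hypOp {G : Type*} [NormedAddCommGroup G] [NormedSpace ℝ G]
    (T : (SR (DPIdx P Q R S)) →L[ℝ] G) (f : SR (DPIdx P Q R S)) :
    ContDiff ℝ ∞ (fun s : ℝ => T (hypOp R S p₀ q₀ s f)) :=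
  contDiff_infty_apply_of_hasDerivAt_comp (γ := fun s : ℝ => hypOp R S p₀ q₀ s f) (N := hypOpGen R S p₀ q₀)
    (fun T' s => hasDerivAt_apply_hypOp R S p₀ q₀ T' f s) T

/-- **Strong differentiability of the orbit in operator language**: the orbit map `s ↦ hypOp s f` composed with
`hypOpGen` is again continuous (so the slope limits above are continuous in the base point). [folklore] -/
theorem continuous_hypOpGen_hypOp (f : SR (DPIdx P Q R S)) :
    Continuous fun s : ℝ => hypOpGen R S p₀ q₀ (hypOp R S p₀ q₀ s f) :=
  (hypOpGen R S p₀ q₀).continuous.comp (continuous_hypOp_apply R S p₀ q₀ f)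

end HypGen

end RealDualPair

end Literature.RepresentationTheory.KonnoKonno2007

end
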